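import Summits.Ventures.LatticeQCDFlow.Exactness.FlowSamplerPooledVsAlternating
import Summits.Ventures.LatticeQCDFlow.Exactness.Phi4HMCCarreDuChamp
import HarnessLib

/-!
# The flow + HMC HYBRID on lattice φ⁴: mixing the exact flow sampler with HMC trajectories inherits the better arm up to its weight, observable by observable

HONEST FRAMING: exact (Metropolis-corrected) sampling algorithms for lattice gauge theory;
figures of merit are autocorrelation/cost numbers at stated couplings and volumes; no
continuum-physics claim.  (SCALAR calibration rung S0-A: not a gauge result.)

Venture `LatticeQCDFlow` (cell pub-lqcd), topic `Exactness`; FANOUT row 2 (`s0-phi4`).  NEW WORK of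
the cell: the lattice instance of the mixture theorem `Exactness/ReversibleMixture.lean` for the
two non-local arms of the S0-A calibration — row 2's exact flow sampler `imhOpPhi4 J λ q̃` (any
positive model density) and row 2's HMC update `hmcOpPhi4 J λ δ N` (any step size, any trajectory
length) — acting on the bounded measurable observables `BddObs` of lattice φ⁴ (every `λ > 0`, real
`J`).  Nothing is cited as a fact.  Printed counterparts NAMED ONLY: "hybrid" kernel mixtures
(Tierney 1994 §2.4); flow-augmented HMC / MCMC with generative proposals as practised in the
2019–2026 flow literature (named in HOME/SCOPING.md; no result of theirs is used).

## What is proved (`M` any operator with `M f φ = a·(imhOpPhi4 J λ q̃ f φ) + (1 − a)·(hmcOpPhi4 J λ δ N f φ)`,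
## `0 < a < 1`; `g ∈ BddObs` with `Var g > 0`; `τ_int` per update, when the normalised series are summable)

* **`phi4Hybrid_tauInt_add_half_le_flow`** — `τ_int,M(g) + ½ ≤ (τ_int,flow(g) + ½) / a`;
* **`phi4Hybrid_tauInt_add_half_le_hmc`** — `τ_int,M(g) + ½ ≤ (τ_int,HMC(g) + ½) / (1 − a)`.

Reading (no numerics implied): tossing an `a`-coin between a flow proposal (global: decorrelates the
slow/topological mode whenever the model covers it) and an HMC trajectory (local: decorrelates the
bulk modes at fixed cost) gives an exact sampler whose integrated autocorrelation time of ANY bounded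
observable is, in `τ + ½`, at most `1/a` times the flow's and at most `1/(1 − a)` times HMC's — each
observable is served by whichever arm serves it best, at the price of that arm's weight.  The
unconditional Abel forms are `RevOp.abelSum_mix_le`.  NOT CLAIMED: that the hybrid beats both arms
(it can); cost accounting (a flow proposal and a trajectory have different prices — the inequality is
per update); deterministic alternation; any number for any run or trained flow.
-/

namespace Summit.Ventures.LatticeQCDFlow.Exactness

open Real MeasureTheory Filter Set Topology
open Summit.Ventures.LatticeQCDFlow.Scoring

section Lattice

variable {n : ℕ}

/-- The `RevOp` hypotheses of row 2's HMC update on `BddObs`, packaged. -/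
theorem hmcOpPhi4_revOp_bddObs {lam : ℝ} (hlam : 0 < lam) (J : Fin (n + 1) → Fin (n + 1) → ℝ)
    (δ : ℝ) (N : ℕ) :
    (∀ ⦃f : (Fin (n + 1) → ℝ) → ℝ⦄, BddObs f → BddObs (hmcOpPhi4 J lam δ N f)) ∧
    (∀ ⦃f h : (Fin (n + 1) → ℝ) → ℝ⦄ (c : ℝ), BddObs f → BddObs h →
        ∀ x, hmcOpPhi4 J lam δ N (fun s => f s + c * h s) x
          = hmcOpPhi4 J lam δ N f x + c * hmcOpPhi4 J lam δ N h x) ∧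
    (∀ ⦃f h : (Fin (n + 1) → ℝ) → ℝ⦄, BddObs f → BddObs h →
        ∫ x, hmcOpPhi4 J lam δ N f x * h x * gibbsWeight J lam x
          = ∫ x, f x * hmcOpPhi4 J lam δ N h x * gibbsWeight J lam x) ∧
    (∀ ⦃f : (Fin (n + 1) → ℝ) → ℝ⦄, BddObs f →
        ∫ x, hmcOpPhi4 J lam δ N f x ^ 2 * gibbsWeight J lam x ≤ ∫ x, f x ^ 2 * gibbsWeight J lam x) := by
  have hco := latticePhi4Action_coercive hlam J
  have hΨm := measurable_hmcProposal (Λ := Fin (n + 1)) J lam δ N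
  have hΨi := hmcProposal_involutive (Λ := Fin (n + 1)) J lam δ N
  have hΨμ := measurePreserving_hmcProposal (Λ := Fin (n + 1)) J lam δ N
  refine ⟨fun f hf => ?_, fun f h c hf hh x => ?_, fun f h hf hh => ?_, fun f hf => ?_⟩
  · exact bddObs_hmcOpOf J lam hΨm hf
  · exact hmcOpOf_add_mul_bddObs J lam hΨm hf hh c x
  · exact hmcOpOf_reversible_bddObs one_pos hco hΨm hΨi hΨμ hf hh
  · exact hmcOpOf_contraction_bddObs one_pos hco hΨm hΨi hΨμ hf

/-- The `RevOp` hypotheses of row 2's flow sampler on `BddObs`, packaged (lattice form). -/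
theorem imhOpPhi4_revOp_bddObs {lam : ℝ} (hlam : 0 < lam) (J : Fin (n + 1) → Fin (n + 1) → ℝ)
    {q : (Fin (n + 1) → ℝ) → ℝ} (hq0 : ∀ φ, 0 < q φ) (hqm : Measurable q) (hqi : Integrable q)
    (hq1 : ∫ φ, q φ = 1) :
    (∀ ⦃f : (Fin (n + 1) → ℝ) → ℝ⦄, BddObs f → BddObs (imhOpPhi4 J lam q f)) ∧
    (∀ ⦃f h : (Fin (n + 1) → ℝ) → ℝ⦄ (c : ℝ), BddObs f → BddObs h →
        ∀ x, imhOpPhi4 J lam q (fun s => f s + c * h s) x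
          = imhOpPhi4 J lam q f x + c * imhOpPhi4 J lam q h x) ∧
    (∀ ⦃f h : (Fin (n + 1) → ℝ) → ℝ⦄, BddObs f → BddObs h →
        ∫ x, imhOpPhi4 J lam q f x * h x * gibbsWeight J lam x
          = ∫ x, f x * imhOpPhi4 J lam q h x * gibbsWeight J lam x) ∧
    (∀ ⦃f : (Fin (n + 1) → ℝ) → ℝ⦄, BddObs f →
        ∫ x, imhOpPhi4 J lam q f x ^ 2 * gibbsWeight J lam x ≤ ∫ x, f x ^ 2 * gibbsWeight J lam x) := by
  have hwi := integrable_gibbsWeight hlam J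
  have hw0 : ∀ φ : Fin (n + 1) → ℝ, 0 < gibbsWeight J lam φ := fun φ => gibbsWeight_pos J lam φ
  have hwm : Measurable (gibbsWeight J lam) := (continuous_gibbsWeight J lam).measurable
  rw [imhOpPhi4_eq_imhOp]
  exact imhOp_revOp (μ := volume) hw0 hwm hwi hq0 hqm hqi hq1

/-- **HYBRID vs FLOW.**  `λ > 0`, real `J`, positive measurable model density `q̃` (`∫ q̃ = 1`), any
`δ`, `N`; `M f = a·(flow update) + (1 − a)·(HMC update)` with `0 < a ≤ 1`; `g ∈ BddObs` with
`∫ (g − ⟨g⟩)² e^{−S} > 0`, normalised autocorrelation series of `g − ⟨g⟩` summable under the flow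
sampler and under `M`.  Then  `τ_int,M(g) + ½ ≤ (τ_int,flow(g) + ½) / a`. -/
theorem phi4Hybrid_tauInt_add_half_le_flow {lam : ℝ} (hlam : 0 < lam)
    (J : Fin (n + 1) → Fin (n + 1) → ℝ)
    {q : (Fin (n + 1) → ℝ) → ℝ} (hq0 : ∀ φ, 0 < q φ) (hqm : Measurable q) (hqi : Integrable q)
    (hq1 : ∫ φ, q φ = 1) (δ : ℝ) (N : ℕ) {a : ℝ} (ha0 : 0 < a) (ha1 : a ≤ 1)
    {M : ((Fin (n + 1) → ℝ) → ℝ) → ((Fin (n + 1) → ℝ) → ℝ)}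
    (hM : ∀ f φ, M f φ = a * imhOpPhi4 J lam q f φ + (1 - a) * hmcOpPhi4 J lam δ N f φ)
    {g : (Fin (n + 1) → ℝ) → ℝ} (hg : BddObs g)
    (hP : 0 < ∫ φ, (g φ - gibbsExpect J lam g) ^ 2 * gibbsWeight J lam φ)
    (hsF : Summable fun k => (∫ φ, (g φ - gibbsExpect J lam g)
        * ((imhOpPhi4 J lam q)^[k + 1] (fun ψ => g ψ - gibbsExpect J lam g)) φ * gibbsWeight J lam φ)
        / ∫ φ, (g φ - gibbsExpect J lam g) ^ 2 * gibbsWeight J lam φ)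
    (hsM : Summable fun k => (∫ φ, (g φ - gibbsExpect J lam g)
        * (M^[k + 1] (fun ψ => g ψ - gibbsExpect J lam g)) φ * gibbsWeight J lam φ)
        / ∫ φ, (g φ - gibbsExpect J lam g) ^ 2 * gibbsWeight J lam φ) :
    tauInt (fun k => (∫ φ, (g φ - gibbsExpect J lam g)
          * (M^[k] (fun ψ => g ψ - gibbsExpect J lam g)) φ * gibbsWeight J lam φ)
          / ∫ φ, (g φ - gibbsExpect J lam g) ^ 2 * gibbsWeight J lam φ) + 1 / 2
      ≤ (tauInt (fun k => (∫ φ, (g φ - gibbsExpect J lam g)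
          * ((imhOpPhi4 J lam q)^[k] (fun ψ => g ψ - gibbsExpect J lam g)) φ * gibbsWeight J lam φ)
          / ∫ φ, (g φ - gibbsExpect J lam g) ^ 2 * gibbsWeight J lam φ) + 1 / 2) / a := by
  have hco := latticePhi4Action_coercive hlam J
  obtain ⟨hS₁, hL₁, hY₁, hC₁⟩ := imhOpPhi4_revOp_bddObs hlam J hq0 hqm hqi hq1
  obtain ⟨hS₂, hL₂, hY₂, hC₂⟩ := hmcOpPhi4_revOp_bddObs hlam J δ N
  have hgc : BddObs (fun ψ => g ψ - gibbsExpect J lam g) := by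
    have h := bddObs_add_mul hg (bddObs_const 1) (-gibbsExpect J lam g)
    have e : (fun φ => g φ + -gibbsExpect J lam g * (1 : ℝ)) = fun ψ => g ψ - gibbsExpect J lam g :=
      funext fun φ => by ring
    rw [e] at h
    exact h
  exact RevOp.tauInt_mix_add_half_le (μ := volume) (A := BddObs)
    (K₁ := imhOpPhi4 J lam q) (K₂ := hmcOpPhi4 J lam δ N) (M := M) (w := gibbsWeight J lam)
    (fun φ => (gibbsWeight_pos J lam φ).le)
    (fun f h hf hh => bddObs_integrable_mul_mul_gibbsWeight one_pos hco hf hh)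
    (fun f h c hf hh => bddObs_add_mul hf hh c)
    hS₁ hS₂ hL₁ hL₂ hY₁ hY₂ hC₁ hC₂ hM ha0 ha1 hgc hP hsF hsM

/-- **HYBRID vs HMC.**  Same setting with `0 ≤ a < 1` and summability under the HMC update and
under `M`:  `τ_int,M(g) + ½ ≤ (τ_int,HMC(g) + ½) / (1 − a)`. -/
theorem phi4Hybrid_tauInt_add_half_le_hmc {lam : ℝ} (hlam : 0 < lam)
    (J : Fin (n + 1) → Fin (n + 1) → ℝ)
    {q : (Fin (n + 1) → ℝ) → ℝ} (hq0 : ∀ φ, 0 < q φ) (hqm : Measurable q) (hqi : Integrable q)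
    (hq1 : ∫ φ, q φ = 1) (δ : ℝ) (N : ℕ) {a : ℝ} (ha0 : 0 ≤ a) (ha1 : a < 1)
    {M : ((Fin (n + 1) → ℝ) → ℝ) → ((Fin (n + 1) → ℝ) → ℝ)}
    (hM : ∀ f φ, M f φ = a * imhOpPhi4 J lam q f φ + (1 - a) * hmcOpPhi4 J lam δ N f φ)
    {g : (Fin (n + 1) → ℝ) → ℝ} (hg : BddObs g)
    (hP : 0 < ∫ φ, (g φ - gibbsExpect J lam g) ^ 2 * gibbsWeight J lam φ)
    (hsH : Summable fun k => (∫ φ, (g φ - gibbsExpect J lam g)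
        * ((hmcOpPhi4 J lam δ N)^[k + 1] (fun ψ => g ψ - gibbsExpect J lam g)) φ * gibbsWeight J lam φ)
        / ∫ φ, (g φ - gibbsExpect J lam g) ^ 2 * gibbsWeight J lam φ)
    (hsM : Summable fun k => (∫ φ, (g φ - gibbsExpect J lam g)
        * (M^[k + 1] (fun ψ => g ψ - gibbsExpect J lam g)) φ * gibbsWeight J lam φ)
        / ∫ φ, (g φ - gibbsExpect J lam g) ^ 2 * gibbsWeight J lam φ) :
    tauInt (fun k => (∫ φ, (g φ - gibbsExpect J lam g)
          * (M^[k] (fun ψ => g ψ - gibbsExpect J lam g)) φ * gibbsWeight J lam φ)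
          / ∫ φ, (g φ - gibbsExpect J lam g) ^ 2 * gibbsWeight J lam φ) + 1 / 2
      ≤ (tauInt (fun k => (∫ φ, (g φ - gibbsExpect J lam g)
          * ((hmcOpPhi4 J lam δ N)^[k] (fun ψ => g ψ - gibbsExpect J lam g)) φ * gibbsWeight J lam φ)
          / ∫ φ, (g φ - gibbsExpect J lam g) ^ 2 * gibbsWeight J lam φ) + 1 / 2) / (1 - a) := by
  have hco := latticePhi4Action_coercive hlam J
  obtain ⟨hS₁, hL₁, hY₁, hC₁⟩ := imhOpPhi4_revOp_bddObs hlam J hq0 hqm hqi hq1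
  obtain ⟨hS₂, hL₂, hY₂, hC₂⟩ := hmcOpPhi4_revOp_bddObs hlam J δ N
  have hgc : BddObs (fun ψ => g ψ - gibbsExpect J lam g) := by
    have h := bddObs_add_mul hg (bddObs_const 1) (-gibbsExpect J lam g)
    have e : (fun φ => g φ + -gibbsExpect J lam g * (1 : ℝ)) = fun ψ => g ψ - gibbsExpect J lam g :=
      funext fun φ => by ring
    rw [e] at h
    exact h
  -- the same mixture read with the HMC arm first: weight `1 − a`
  have hM' : ∀ f φ, M f φ = (1 - a) * hmcOpPhi4 J lam δ N f φ
      + (1 - (1 - a)) * imhOpPhi4 J lam q f φ := fun f φ => by rw [hM]; ring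
  exact RevOp.tauInt_mix_add_half_le (μ := volume) (A := BddObs)
    (K₁ := hmcOpPhi4 J lam δ N) (K₂ := imhOpPhi4 J lam q) (M := M) (w := gibbsWeight J lam)
    (fun φ => (gibbsWeight_pos J lam φ).le)
    (fun f h hf hh => bddObs_integrable_mul_mul_gibbsWeight one_pos hco hf hh)
    (fun f h c hf hh => bddObs_add_mul hf hh c)
    hS₂ hS₁ hL₂ hL₁ hY₂ hY₁ hC₂ hC₁ hM' (by linarith) (by linarith) hgc hP hsH hsM

end Lattice

end Summit.Ventures.LatticeQCDFlow.Exactness
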